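import Summits.NavierStokesRegularity.FluidComputer.AngularGalerkinLadder
import Literature.Analysis.FluidPDE.IsometryInvariance
import Literature.Analysis.FluidPDE.AxisymmetricVorticityTransport

/-!
# The Casimir cut commutes with rotations: band-limitedness and co-band-limitedness are invariant
# under conjugation `U ↦ R ∘ U ∘ R⁻¹` by every cross-product-preserving linear isometry

Circuit seat (ns-blowup-circuit g10), route-independent kernel tools `--supports` crux K1
`RungBlowupCofinal` (stmt-NavierStokesRegularity-19959, helper lane); no definition, no named fact.

## Why

The vocabulary of route `AngularGalerkinLadder` (`FluidComputer/AngularGalerkinLadder.lean`) states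
the isotypic cut WITHOUT a projection operator: a field is band-limited to degree `≤ L` iff
`∏_{j ≤ L}(𝒞 − j(j+1)) U = 0` for the Casimir `𝒞 = −Σ_a J_a²` of the three rotation generators
`(J_a U)(x) = e_a × U(x) − DU(x)[e_a × x]`. That this class is ROTATION INVARIANT — the basic
representation-theoretic fact behind the whole ladder (the cut is an SO(3)-equivariant
projection) — was so far only prose in the docstrings. This file proves it in the kernel, in the
generality the route uses: for every linear isometry `R` of `ℝ³` preserving the cross product
(every proper rotation; `hR : R (a × b) = R a × R b`) and every smooth `U`,
* `angGen_conj` / `angGen_conj_sum`: `J_a (R U R⁻¹)(x) = R [Σ_b ⟨R⁻¹e_a⟩_b J_b U](R⁻¹x)` (the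
  generators transform as a vector: general-axis generator `G_v U = v × U − DU[v × ·]`, `gen_sum`);
* `casimir_conj`: `𝒞(R U R⁻¹)(x) = R (𝒞 U)(R⁻¹x)` — the sum of squares over the rotated orthonormal
  frame `{R⁻¹e_a}` equals the sum over `{e_a}` (`sum_symm_axis_mul`: `Σ_a ⟨R⁻¹e_a⟩_d⟨R⁻¹e_a⟩_b = δ_db`,
  i.e. `RRᵀ = 1`; no commutation relations of the `J_a` are needed);
* `bandDefect_conj`, **`isBandLimited_conj`**: the band defect is conjugation covariant, so
  `IsBandLimited L U → IsBandLimited L (R U R⁻¹)`;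
* **`isCobandLimited_conj`**: the dual statement for the Galerkin defect class (test against
  `R⁻¹ψR`, measure-preserving change of variables);
* `rotZ_cross`, `rotZLIE_cross`: the rotations `rotZ θ` about `e₃` preserve the cross product,
  whence `isBandLimited_rotZ_conj`, `isCobandLimited_rotZ_conj` — exactly the hypotheses `hband`,
  `hcob` of `PrecessingLerayLineRungProfile.lean` (p518969) for the slices
  `λ rotZ(θ) U(λ rotZ(−θ) x)` of a precessing Leray-type field (combine with the dilation
  invariance `isBandLimited_smul_comp_smul` / `isCobandLimited_smul_comp_smul` of
  `LerayLineRungProfile.lean`, p517517).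
Also: smoothness bookkeeping `contDiff_angGen`, `contDiff_casimir`, `contDiff_bandDefect` (smooth
fields have smooth generators / Casimir images / band defects).

LABEL: KERNEL (calculus / linear algebra). WHAT THIS IS NOT: not NS — no field is constructed, no
profile, no item moves; improper isometries (`R(a × b) = −Ra × Rb`) are not treated (they also
preserve the class, by the same proof with a sign, not needed here).
References: [cite: BullardGellman1954] (vector spherical harmonics; isotypic components are
rotation invariant); [cite: PineauVicol2026, (1.7)] (the precessing ansatz whose slices this serves).
-/

noncomputable section

namespace Summit.NavierStokesRegularity.AngularGalerkinLadderCasimirRotation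

open Set Function MeasureTheory
open scoped Matrix
open scoped RealInnerProductSpace ContDiff
open Literature.Analysis.FluidPDE
open Summit.NavierStokesRegularity.FluidComputer
open Summit.NavierStokesRegularity.FluidComputer.AngularLadder

variable (R : EuclideanSpace ℝ (Fin 3) ≃ₗᵢ[ℝ] EuclideanSpace ℝ (Fin 3))

/-- A cross-product-preserving isometry also has a cross-product-preserving inverse. [folklore] -/
theorem symm_cross (hR : ∀ a b, R (cross a b) = cross (R a) (R b))
    (a b : EuclideanSpace ℝ (Fin 3)) : R.symm (cross a b) = cross (R.symm a) (R.symm b) := by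
  apply R.injective
  rw [LinearIsometryEquiv.apply_symm_apply, hR, LinearIsometryEquiv.apply_symm_apply,
    LinearIsometryEquiv.apply_symm_apply]

/-- The generator with a general axis vector `v`: `G_v U x = v × U(x) − DU(x)[v × x]`; it is
linear in `v`, and on the coordinate axes it is `angGen`. [folklore] -/
theorem gen_axis (a : Fin 3) (U : EuclideanSpace ℝ (Fin 3) → EuclideanSpace ℝ (Fin 3))
    (x : EuclideanSpace ℝ (Fin 3)) :
    angGen a U x = cross (axis a) (U x) - fderiv ℝ U x (cross (axis a) x) := rfl

/-- Expansion of the general-axis generator in the coordinate axes: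
`G_v U x = Σ_b v_b • (J_b U)(x)`. [folklore] -/
theorem gen_sum (v : EuclideanSpace ℝ (Fin 3)) (U : EuclideanSpace ℝ (Fin 3) → EuclideanSpace ℝ (Fin 3))
    (x : EuclideanSpace ℝ (Fin 3)) :
    cross v (U x) - fderiv ℝ U x (cross v x) = ∑ b : Fin 3, v b • angGen b U x := by
  have hv : v = ∑ b : Fin 3, v b • axis b := by
    simpa [axis] using ((EuclideanSpace.basisFun (Fin 3) ℝ).sum_repr v).symm
  conv_lhs => rw [hv]
  simp only [angGen]
  rw [show cross (∑ b : Fin 3, v b • axis b) (U x) = ∑ b : Fin 3, v b • cross (axis b) (U x) by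
        rw [← crossCLM_apply, map_sum]; simp [map_smul],
      show cross (∑ b : Fin 3, v b • axis b) x = ∑ b : Fin 3, v b • cross (axis b) x by
        rw [← crossCLM_apply, map_sum]; simp [map_smul],
      map_sum]
  simp only [map_smul, smul_sub, Finset.sum_sub_distrib]

/-- **The rotation generators are conjugation covariant**: for a cross-product-preserving linear
isometry `R`, `J_a (R U R⁻¹)(x) = R [G_{R⁻¹e_a} U](R⁻¹ x)` with the general-axis generator
`G_v U = v × U − DU[v × ·]`. [folklore] -/
theorem angGen_conj (hR : ∀ a b, R (cross a b) = cross (R a) (R b)) (a : Fin 3)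
    (U : EuclideanSpace ℝ (Fin 3) → EuclideanSpace ℝ (Fin 3)) (x : EuclideanSpace ℝ (Fin 3)) :
    angGen a (fun y => R (U (R.symm y))) x =
      R (cross (R.symm (axis a)) (U (R.symm x)) -
        fderiv ℝ U (R.symm x) (cross (R.symm (axis a)) (R.symm x))) := by
  rw [gen_axis, fderiv_conj_linearIsometryEquiv]
  have h1 : cross (axis a) (R (U (R.symm x))) = R (cross (R.symm (axis a)) (U (R.symm x))) := by
    rw [hR, LinearIsometryEquiv.apply_symm_apply]
  rw [h1, map_sub]
  simp only [ContinuousLinearMap.coe_comp, Function.comp_apply, LinearIsometryEquiv.coe_coe,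
    ContinuousLinearEquiv.coe_coe]
  rw [symm_cross R hR]

/-- Covariance in coordinates: `J_a (R U R⁻¹)(x) = R Σ_b ⟨R⁻¹e_a⟩_b (J_b U)(R⁻¹x)`. [folklore] -/
theorem angGen_conj_sum (hR : ∀ a b, R (cross a b) = cross (R a) (R b)) (a : Fin 3)
    (U : EuclideanSpace ℝ (Fin 3) → EuclideanSpace ℝ (Fin 3)) (x : EuclideanSpace ℝ (Fin 3)) :
    angGen a (fun y => R (U (R.symm y))) x =
      R (∑ b : Fin 3, (R.symm (axis a)) b • angGen b U (R.symm x)) := by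
  rw [angGen_conj R hR, gen_sum]

/-- The generators are linear in the field (at points where the summands are differentiable). [folklore] -/
theorem angGen_sum_smul (a : Fin 3) (c : Fin 3 → ℝ)
    (V : Fin 3 → EuclideanSpace ℝ (Fin 3) → EuclideanSpace ℝ (Fin 3)) (x : EuclideanSpace ℝ (Fin 3))
    (hV : ∀ b, DifferentiableAt ℝ (V b) x) :
    angGen a (fun y => ∑ b : Fin 3, c b • V b y) x = ∑ b : Fin 3, c b • angGen a (V b) x := by
  have hfun : (fun y => ∑ b : Fin 3, c b • V b y) = ∑ b : Fin 3, (c b • V b) := by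
    funext y; simp only [Finset.sum_apply, Pi.smul_apply]
  have hsum : HasFDerivAt (fun y => ∑ b : Fin 3, c b • V b y)
      (∑ b : Fin 3, c b • fderiv ℝ (V b) x) x := by
    rw [hfun]
    exact HasFDerivAt.sum fun b _ => ((hV b).hasFDerivAt.const_smul (c b))
  simp only [angGen]
  rw [hsum.fderiv, FunLike.coe_sum, Finset.sum_apply]
  rw [show cross (axis a) (∑ b : Fin 3, c b • V b x) = ∑ b : Fin 3, c b • cross (axis a) (V b x) by
    rw [← crossCLM_apply, map_sum]; simp [map_smul]]
  rw [← Finset.sum_sub_distrib]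
  refine Finset.sum_congr rfl fun b _ => ?_
  rw [FunLike.coe_smul, Pi.smul_apply, smul_sub]

/-! ### Smoothness of the generators -/

/-- Smooth fields have smooth generators. [folklore] -/
theorem contDiff_angGen {U : EuclideanSpace ℝ (Fin 3) → EuclideanSpace ℝ (Fin 3)}
    (hU : ContDiff ℝ ∞ U) (b : Fin 3) : ContDiff ℝ ∞ (angGen b U) := by
  have h1 : ContDiff ℝ ∞ (fun y => cross (axis b) (U y)) := by
    have : (fun y => cross (axis b) (U y)) = fun y => crossCLM (axis b) (U y) := rfl
    rw [this]; exact (crossCLM (axis b)).contDiff.comp hU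
  have h2 : ContDiff ℝ ∞ (fun y : EuclideanSpace ℝ (Fin 3) => fderiv ℝ U y (cross (axis b) y)) := by
    rw [contDiff_infty]
    intro n
    have hd : ContDiff ℝ n (fderiv ℝ U) := hU.fderiv_right (by exact_mod_cast le_top)
    have hc : ContDiff ℝ n (fun y : EuclideanSpace ℝ (Fin 3) => cross (axis b) y) :=
      ((crossCLM (axis b)).contDiff).of_le (by exact_mod_cast le_top)
    exact hd.clm_apply hc
  exact h1.sub h2

/-- Smooth fields have a smooth Casimir image. [folklore] -/
theorem contDiff_casimir {U : EuclideanSpace ℝ (Fin 3) → EuclideanSpace ℝ (Fin 3)}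
    (hU : ContDiff ℝ ∞ U) : ContDiff ℝ ∞ (casimir U) := by
  have : casimir U = fun x => -∑ a : Fin 3, angGen a (angGen a U) x := rfl
  rw [this]
  exact (ContDiff.sum fun a _ => contDiff_angGen (contDiff_angGen hU a) a).neg

/-- Smooth fields have smooth band defects. [folklore] -/
theorem contDiff_bandDefect {U : EuclideanSpace ℝ (Fin 3) → EuclideanSpace ℝ (Fin 3)}
    (hU : ContDiff ℝ ∞ U) : ∀ L : ℕ, ContDiff ℝ ∞ (bandDefect L U)
  | 0 => contDiff_casimir hU
  | L + 1 => by
      have ih := contDiff_bandDefect hU L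
      have : bandDefect (L + 1) U = fun x => casimir (bandDefect L U) x -
          (((L : ℝ) + 1) * ((L : ℝ) + 2)) • bandDefect L U x := rfl
      rw [this]
      exact (contDiff_casimir ih).sub (ih.const_smul _)

/-! ### Orthogonality of the rotated frame -/

/-- `Σ_a ⟨R⁻¹e_a⟩_d ⟨R⁻¹e_a⟩_b = δ_{db}`: the rows `R⁻¹e_a` form an orthonormal frame. [folklore] -/
theorem sum_symm_axis_mul (d b : Fin 3) :
    ∑ a : Fin 3, (R.symm (axis a)) d * (R.symm (axis a)) b = if d = b then 1 else 0 := by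
  have hc : ∀ a e : Fin 3, (R.symm (axis a)) e = (R (axis e)) a := by
    intro a e
    have h1 : (R.symm (axis a)) e = ⟪R.symm (axis a), axis e⟫ := by
      simp [axis, EuclideanSpace.inner_single_right]
    have h2 : (R (axis e)) a = ⟪axis a, R (axis e)⟫ := by
      simp [axis, EuclideanSpace.inner_single_left]
    rw [h1, h2, ← R.inner_map_map (R.symm (axis a)) (axis e), LinearIsometryEquiv.apply_symm_apply]
  simp_rw [hc]
  have h3 : ∑ a : Fin 3, (R (axis d)) a * (R (axis b)) a = ⟪R (axis d), R (axis b)⟫ := by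
    rw [PiLp.inner_apply]
    refine Finset.sum_congr rfl fun a _ => ?_
    simp [mul_comm]
  rw [h3, R.inner_map_map]
  simp [axis, EuclideanSpace.inner_single_left]

/-! ### The Casimir operator and the band defect commute with conjugation -/

/-- **The Casimir operator is conjugation covariant**: `𝒞(R U R⁻¹)(x) = R (𝒞U)(R⁻¹ x)` for smooth
`U` and a cross-product-preserving linear isometry `R`. [folklore] -/
theorem casimir_conj (hR : ∀ a b, R (cross a b) = cross (R a) (R b))
    {U : EuclideanSpace ℝ (Fin 3) → EuclideanSpace ℝ (Fin 3)} (hU : ContDiff ℝ ∞ U)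
    (x : EuclideanSpace ℝ (Fin 3)) :
    casimir (fun y => R (U (R.symm y))) x = R (casimir U (R.symm x)) := by
  set c : Fin 3 → Fin 3 → ℝ := fun a b => (R.symm (axis a)) b with hcdef
  set W : Fin 3 → EuclideanSpace ℝ (Fin 3) → EuclideanSpace ℝ (Fin 3) :=
    fun a z => ∑ b : Fin 3, c a b • angGen b U z with hWdef
  have hdiff : ∀ (b : Fin 3) (z : EuclideanSpace ℝ (Fin 3)), DifferentiableAt ℝ (angGen b U) z :=
    fun b z => ((contDiff_angGen hU b).differentiable (by simp)).differentiableAt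
  have step1 : ∀ a : Fin 3, angGen a (fun y => R (U (R.symm y))) = fun y => R (W a (R.symm y)) := by
    intro a; funext y; rw [angGen_conj_sum R hR]
  have step2 : ∀ a : Fin 3, angGen a (angGen a (fun y => R (U (R.symm y)))) x =
      R (∑ d : Fin 3, c a d • ∑ b : Fin 3, c a b • angGen d (angGen b U) (R.symm x)) := by
    intro a
    rw [step1 a, angGen_conj_sum R hR a (W a) x]
    congr 1
    refine Finset.sum_congr rfl fun d _ => ?_
    rw [hWdef]
    rw [angGen_sum_smul d (c a) (fun b => angGen b U) (R.symm x) (fun b => hdiff b _)]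
  have key : ∀ T : Fin 3 → Fin 3 → EuclideanSpace ℝ (Fin 3),
      ∑ a : Fin 3, ∑ d : Fin 3, c a d • ∑ b : Fin 3, c a b • T d b = ∑ b : Fin 3, T b b := by
    intro T
    calc ∑ a : Fin 3, ∑ d : Fin 3, c a d • ∑ b : Fin 3, c a b • T d b
        = ∑ a : Fin 3, ∑ d : Fin 3, ∑ b : Fin 3, (c a d * c a b) • T d b := by
          simp only [Finset.smul_sum, smul_smul]
      _ = ∑ d : Fin 3, ∑ a : Fin 3, ∑ b : Fin 3, (c a d * c a b) • T d b := Finset.sum_comm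
      _ = ∑ d : Fin 3, ∑ b : Fin 3, ∑ a : Fin 3, (c a d * c a b) • T d b := by
          refine Finset.sum_congr rfl fun d _ => ?_
          exact Finset.sum_comm
      _ = ∑ d : Fin 3, ∑ b : Fin 3, (∑ a : Fin 3, c a d * c a b) • T d b := by
          simp only [Finset.sum_smul]
      _ = ∑ d : Fin 3, ∑ b : Fin 3, (if d = b then (1 : ℝ) else 0) • T d b := by
          simp only [hcdef, sum_symm_axis_mul R]
      _ = ∑ b : Fin 3, T b b := by
          simp [ite_smul, Finset.sum_ite_eq]
  simp only [casimir, step2, ← map_sum, ← map_neg, key]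

/-- **The band defect is conjugation covariant**: `bandDefect L (R U R⁻¹) = R (bandDefect L U) R⁻¹`
for smooth `U`. [folklore] -/
theorem bandDefect_conj (hR : ∀ a b, R (cross a b) = cross (R a) (R b))
    {U : EuclideanSpace ℝ (Fin 3) → EuclideanSpace ℝ (Fin 3)} (hU : ContDiff ℝ ∞ U) :
    ∀ L : ℕ, bandDefect L (fun y => R (U (R.symm y))) = fun x => R (bandDefect L U (R.symm x))
  | 0 => by
      funext x
      exact casimir_conj R hR hU x
  | L + 1 => by
      funext x
      have ih := bandDefect_conj hR hU L
      show casimir (bandDefect L fun y => R (U (R.symm y))) x -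
          (((L : ℝ) + 1) * ((L : ℝ) + 2)) • bandDefect L (fun y => R (U (R.symm y))) x =
        R (casimir (bandDefect L U) (R.symm x) -
          (((L : ℝ) + 1) * ((L : ℝ) + 2)) • bandDefect L U (R.symm x))
      rw [ih, casimir_conj R hR (contDiff_bandDefect hU L), map_sub, map_smul]

/-- **Band-limitedness is rotation invariant**: if `U` is band-limited to degree `≤ L` about the
origin then so is the conjugate `x ↦ R (U (R⁻¹ x))` by any cross-product-preserving linear isometry
`R` (every proper rotation). [cite: BullardGellman1954] -/
theorem isBandLimited_conj (hR : ∀ a b, R (cross a b) = cross (R a) (R b)) {L : ℕ}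
    {U : EuclideanSpace ℝ (Fin 3) → EuclideanSpace ℝ (Fin 3)} (h : IsBandLimited L U) :
    IsBandLimited L (fun y => R (U (R.symm y))) := by
  refine ⟨?_, fun x => ?_⟩
  · exact (R : EuclideanSpace ℝ (Fin 3) →L[ℝ] EuclideanSpace ℝ (Fin 3)).contDiff.comp
      (h.1.comp (R.symm : EuclideanSpace ℝ (Fin 3) →L[ℝ] EuclideanSpace ℝ (Fin 3)).contDiff)
  · rw [bandDefect_conj R hR h.1 L]
    show R (bandDefect L U (R.symm x)) = 0
    rw [h.2, map_zero]

/-- **Co-band-limitedness is rotation invariant**: if `D` is `L²`-orthogonal to every compactly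
supported band-limited field, so is `x ↦ R (D (R⁻¹ x))` — test against `y ↦ R⁻¹ ψ(R y)`
(band-limited by `isBandLimited_conj` for `R⁻¹`, compactly supported) after the measure-preserving
change of variables `x = R y`. [folklore] -/
theorem isCobandLimited_conj (hR : ∀ a b, R (cross a b) = cross (R a) (R b)) {L : ℕ}
    {D : EuclideanSpace ℝ (Fin 3) → EuclideanSpace ℝ (Fin 3)} (h : IsCobandLimited L D) :
    IsCobandLimited L (fun y => R (D (R.symm y))) := by
  intro ψ hψ hsupp
  have hR' : ∀ a b, R.symm (cross a b) = cross (R.symm a) (R.symm b) := symm_cross R hR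
  have hψ' : IsBandLimited L (fun y => R.symm (ψ (R y))) := by
    have := isBandLimited_conj R.symm hR' hψ
    simpa only [LinearIsometryEquiv.symm_symm] using this
  have hsupp' : HasCompactSupport (fun y => R.symm (ψ (R y))) := by
    have h1 : HasCompactSupport (ψ ∘ R.toHomeomorph) := hsupp.comp_homeomorph R.toHomeomorph
    have h2 := h1.comp_left (g := R.symm) (map_zero _)
    exact h2
  have hinner : ∀ x, ⟪R (D (R.symm x)), ψ x⟫ = ⟪D (R.symm x), R.symm (ψ (R (R.symm x)))⟫ := by
    intro x
    rw [LinearIsometryEquiv.apply_symm_apply, ← R.symm.inner_map_map (R (D (R.symm x))) (ψ x),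
      LinearIsometryEquiv.symm_apply_apply]
  have hcv : ∫ x, (fun y => ⟪D y, R.symm (ψ (R y))⟫) (R.symm x) = ∫ y, ⟪D y, R.symm (ψ (R y))⟫ :=
    R.symm.measurePreserving.integral_comp R.symm.toHomeomorph.measurableEmbedding
      (fun y => ⟪D y, R.symm (ψ (R y))⟫)
  calc ∫ x, ⟪R (D (R.symm x)), ψ x⟫
      = ∫ x, (fun y => ⟪D y, R.symm (ψ (R y))⟫) (R.symm x) := by
        congr 1; funext x; exact hinner x
    _ = ∫ y, ⟪D y, R.symm (ψ (R y))⟫ := hcv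
    _ = 0 := h _ hψ' hsupp'

/-! ### Rotations about the axis preserve the cross product -/

/-- `rotZ θ (a × b) = rotZ θ a × rotZ θ b`: the rotations about `e₃` are proper. [folklore] -/
theorem rotZ_cross (θ : ℝ) (a b : EuclideanSpace ℝ (Fin 3)) :
    rotZ θ (cross a b) = cross (rotZ θ a) (rotZ θ b) := by
  have hsc := Real.sin_sq_add_cos_sq θ
  ext i
  fin_cases i <;> simp [cross, rotZ, cross_apply] <;> [ring; ring; linear_combination (a 1 * b 0 - a 0 * b 1) * hsc]

/-- The linear isometry `rotZLIE θ` preserves the cross product. [folklore] -/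
theorem rotZLIE_cross (θ : ℝ) (a b : EuclideanSpace ℝ (Fin 3)) :
    rotZLIE θ (cross a b) = cross (rotZLIE θ a) (rotZLIE θ b) := by
  simp only [rotZLIE_apply, rotZ_cross]

/-- **Band-limitedness is invariant under rotations about an axis** (the case of the precessing
Leray line: the slices of `pvAnsatz α U` are dilated `rotZ`-conjugates of the profile). [cite: BullardGellman1954] -/
theorem isBandLimited_rotZ_conj (θ : ℝ) {L : ℕ}
    {U : EuclideanSpace ℝ (Fin 3) → EuclideanSpace ℝ (Fin 3)} (h : IsBandLimited L U) :
    IsBandLimited L (fun y => rotZ θ (U (rotZ (-θ) y))) := by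
  have := isBandLimited_conj (rotZLIE θ) (rotZLIE_cross θ) h
  simpa only [rotZLIE_apply, rotZLIE_symm_apply] using this

/-- Co-band-limitedness is invariant under rotations about an axis. [folklore] -/
theorem isCobandLimited_rotZ_conj (θ : ℝ) {L : ℕ}
    {D : EuclideanSpace ℝ (Fin 3) → EuclideanSpace ℝ (Fin 3)} (h : IsCobandLimited L D) :
    IsCobandLimited L (fun y => rotZ θ (D (rotZ (-θ) y))) := by
  have := isCobandLimited_conj (rotZLIE θ) (rotZLIE_cross θ) h
  simpa only [rotZLIE_apply, rotZLIE_symm_apply] using this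

end Summit.NavierStokesRegularity.AngularGalerkinLadderCasimirRotation

end
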